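import Mathlib
import HarnessLib
import Summits.HubbardSuperconductivity.HubbardSuperconductivity.Theorems.KLProgrammeKLRegimeSplitFrameEnergyGap
import Summits.HubbardSuperconductivity.HubbardSuperconductivity.Theorems.KLProgrammeKLRegimeSplitLegCount

/-!
# Route `KLProgramme` — crux K3, ENGINE child (gen 4 `KLRegimeEngineV12`, stmt-HubbardSuperconductivity-19855): REACHABLE PARTNER SLICES —
# in the full step-`n` rung weight at a pair-class total momentum, the partner of a slice-`n` leg lies below scale `n − 5`'s support:
# only the slices `m ∈ {n−4, …, n}` contribute (cell gate-hubbard-kl, seat p1 g7; HOME/STATUS 2026-08-27T00:11:57Z ENGINE NOTE)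

The mixed rungs `z^{n>}_p = β⁻¹Σ_ν g_n(ν,p)·g_{>Λ_{n−1}}(−ν, Qm − p)` of the exact one-step ladder identity pair a slice-`n` leg (`|ν| < 4Λ_n`,
`|e_K(p)| < 4Λ_n`) with a partner at `(−ν, Qm − p)`.  For `Qm` in the pair class at resolution `n` (`|Qm|_𝕋 ≤ 4^{−n} = 32Λ_n`) and an admissible
frame (`…SplitFrameEnergyGap`: `|e_K(p) − e_K(Qm − p)| ≤ 7√2·|Qm|_𝕋`), the partner has `|e_K(Qm − p)| < 324Λ_n` and `ν² + e_K(Qm−p)² < (512Λ_n)²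
= (Λ_{n−5}/2)²`, so every slice weight `χ₂(s/Λ_m²) − χ₂(s/Λ_{m−1}²)` with `m + 5 ≤ n` VANISHES there (`klld_weights_eq_zero_of_le`): the sign-blind
total variation of the full rung weight is a sum over at most five partner slices (§6–§8 of `…SplitEdgeFacts(Mixed)` per slice).
* `kled_klTorusNorm_le_of_isPairClassAt` (`|Qm|_𝕋 ≤ 32Λ_n`), `kled_abs_partner_energy_lt` (`|e_K(Qm−p)| < 324Λ_n`), `kled_partner_radius_lt`
  (`ν² + e_K(Qm−p)² < (512Λ_n)²`), `kled_klScale_ge_of_add_five_le` (`m + 5 ≤ n ⇒ 1024Λ_n ≤ Λ_m`), **`kled_partner_sliceWeight_eq_zero`**.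
Everything is proved; no definition, no named fact; nothing about the effective action is asserted.
-/

noncomputable section

namespace Summit.HubbardSuperconductivity.HubbardSuperconductivity.Theorems.KLRegimeSplit

set_option linter.dupNamespace false -- summit = problem name (single-conjunct summit), D-0017

open Real Finset Literature.MathematicalPhysics.QuantumLattice Literature.Probability.LatticeModels
open Summit.HubbardSuperconductivity.HubbardSuperconductivity.Theorems.KLProgrammeLegKernels

section Partner

variable {L : ℕ} [NeZero L] {R : RenConsts} {U : ℝ} {N : ℕ} {μ : ℝ} {K : TrigPolyC4v}

omit [NeZero L] in
/-- **The pair class at resolution `n` in scale units**: `IsPairClassAt L Qm n ⇒ |Qm|_𝕋 ≤ 32·Λ_n` (`Λ_n = 4^{−n}/32`). -/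
theorem kled_klTorusNorm_le_of_isPairClassAt {Qm : TorusSite 2 L} {n : ℕ} (h : IsPairClassAt L Qm n) :
    klTorusNorm L Qm ≤ 32 * klScale klE0 n := by
  have h' : klTorusNorm L Qm ≤ ((4 : ℝ) ^ n)⁻¹ := h
  have : 32 * klScale klE0 n = ((4 : ℝ) ^ n)⁻¹ := by unfold klScale klE0; ring
  rw [this]; exact h'

/-- **The partner's energy**: on an admissible frame, for `Qm` pair-class at `n` and `|e_K(p)| < 4Λ_n`, `|e_K(Qm − p)| < 324·Λ_n`
(`4 + 7·1.42·32 < 324`). -/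
theorem kled_abs_partner_energy_lt (hK : FrameOK R U N μ K) {Qm p : TorusSite 2 L} {n : ℕ} (hQ : IsPairClassAt L Qm n)
    (he : |nambuXiCT L μ K p| < 4 * klScale klE0 n) : |nambuXiCT L μ K (Qm - p)| < 324 * klScale klE0 n := by
  have hgap := kled_abs_nambuXiCT_sub_partner_le_of_frameOK hK p Qm
  have hρ := kled_klTorusNorm_le_of_isPairClassAt hQ
  have hΛ := klth_klScale_pos n
  have hs : Real.sqrt 2 ≤ 71 / 50 := by rw [Real.sqrt_le_left (by norm_num)]; norm_num
  have h1 : 7 * Real.sqrt 2 * klTorusNorm L Qm ≤ 7 * (71 / 50) * (32 * klScale klE0 n) := by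
    have hρ0 : 0 ≤ klTorusNorm L Qm := KLProgrammeLegKernels.torusSupNorm_nonneg _
    have h7 : 7 * Real.sqrt 2 ≤ 7 * (71 / 50) := by linarith
    exact mul_le_mul h7 hρ hρ0 (by norm_num)
  have h2 : |nambuXiCT L μ K (Qm - p)| ≤ |nambuXiCT L μ K p| + |nambuXiCT L μ K p - nambuXiCT L μ K (Qm - p)| := by
    have := abs_sub_abs_le_abs_sub (nambuXiCT L μ K (Qm - p)) (nambuXiCT L μ K p)
    rw [abs_sub_comm] at this; linarith
  linarith

/-- **The partner's radius**: with also `|ν| < 4Λ_n`, `ν² + e_K(Qm − p)² < (512·Λ_n)²`. -/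
theorem kled_partner_radius_lt (hK : FrameOK R U N μ K) {Qm p : TorusSite 2 L} {n : ℕ} (hQ : IsPairClassAt L Qm n)
    {ν : ℝ} (hν : |ν| < 4 * klScale klE0 n) (he : |nambuXiCT L μ K p| < 4 * klScale klE0 n) :
    ν ^ 2 + nambuXiCT L μ K (Qm - p) ^ 2 < (512 * klScale klE0 n) ^ 2 := by
  have h1 := kled_abs_partner_energy_lt hK hQ he
  have hΛ := klth_klScale_pos n
  have hν' : ν ^ 2 < (4 * klScale klE0 n) ^ 2 := by
    have := abs_nonneg ν
    calc ν ^ 2 = |ν| ^ 2 := (sq_abs ν).symm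
      _ < (4 * klScale klE0 n) ^ 2 := by
          exact pow_lt_pow_left₀ hν this (by norm_num)
  have he' : nambuXiCT L μ K (Qm - p) ^ 2 < (324 * klScale klE0 n) ^ 2 := by
    have := abs_nonneg (nambuXiCT L μ K (Qm - p))
    calc nambuXiCT L μ K (Qm - p) ^ 2 = |nambuXiCT L μ K (Qm - p)| ^ 2 := (sq_abs _).symm
      _ < (324 * klScale klE0 n) ^ 2 := pow_lt_pow_left₀ h1 this (by norm_num)
  nlinarith

/-- `m + 5 ≤ n ⇒ 1024·Λ_n ≤ Λ_m` (`Λ_m/Λ_n = 4^{n−m} ≥ 4⁵`). -/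
theorem kled_klScale_ge_of_add_five_le {m n : ℕ} (h : m + 5 ≤ n) : 1024 * klScale klE0 n ≤ klScale klE0 m := by
  have hmn : m ≤ n := by omega
  have hq := klth_klScale_div_klScale hmn
  have hΛm := klth_klScale_pos m
  have hΛn := klth_klScale_pos n
  -- `Λ_n / Λ_m = (4^{n-m})⁻¹ ≤ (4^5)⁻¹ = 1/1024`
  have h45 : ((4 : ℝ) ^ (n - m))⁻¹ ≤ ((4 : ℝ) ^ 5)⁻¹ := by
    apply inv_anti₀ (by positivity)
    exact pow_le_pow_right₀ (by norm_num) (by omega)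
  have hdiv : klScale klE0 n / klScale klE0 m ≤ 1 / 1024 := by
    rw [hq]; norm_num at h45 ⊢; exact h45
  rw [div_le_iff₀ hΛm] at hdiv
  linarith

/-- **REACHABLE PARTNER SLICES**: on an admissible frame, for `Qm` pair-class at resolution `n`, a slice-`n` leg `(ν, p)` (`|ν| < 4Λ_n`,
`|e_K(p)| < 4Λ_n`) and any scale `m` with `m + 5 ≤ n`, the slice-`m` weight of the partner `(−ν, Qm − p)` vanishes:
`χ₂(s/Λ_m²) − χ₂(s/Λ_{m−1}²) = 0` for `s = ν² + e_K(Qm − p)²` and `Λ_{m−1} = 4Λ_m` (indeed both cutoff values are `0`). -/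
theorem kled_partner_sliceWeight_eq_zero (hK : FrameOK R U N μ K) {Qm p : TorusSite 2 L} {n m : ℕ} (hQ : IsPairClassAt L Qm n)
    (hmn : m + 5 ≤ n) {ν : ℝ} (hν : |ν| < 4 * klScale klE0 n) (he : |nambuXiCT L μ K p| < 4 * klScale klE0 n) :
    salmhoferCutoff ((ν ^ 2 + nambuXiCT L μ K (Qm - p) ^ 2) / klScale klE0 m ^ 2) = 0 ∧
      salmhoferCutoff ((ν ^ 2 + nambuXiCT L μ K (Qm - p) ^ 2) / (4 * klScale klE0 m) ^ 2) = 0 := by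
  have hrad := kled_partner_radius_lt hK hQ hν he
  have hbig := kled_klScale_ge_of_add_five_le hmn
  have hΛm := klth_klScale_pos m
  have hΛn := klth_klScale_pos n
  refine klld_weights_eq_zero_of_le hΛm (by linarith) (by positivity) ?_
  -- `(512Λ_n)² ≤ (Λ_m/2)² = Λ_m²/4` since `1024Λ_n ≤ Λ_m`
  nlinarith

end Partner

end Summit.HubbardSuperconductivity.HubbardSuperconductivity.Theorems.KLRegimeSplit

end
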